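import Summits.RiemannHypothesis.RiemannHypothesis.Theorems.ThetaTier2Env
import HarnessLib

/-!
# THETA tier-2 kernel checker — soundness of the CROSS TERM: convolution loop, decreasing hull, `e^{w}`-integral (cc-s2-1; RH-FREE)

(K4), part 2 (HOME/cc-s2-1/gen22/TIER2-KERNEL-SPEC.md §2 «Cross term (E4/E5)» / §5 (K4) / §6(c)).  For the run `stage1 A` and ANY reals
`0 ≤ τ̄ ≤ val tau`, `0 ≤ E ≤ val ehStep`:

* `convLoop` (`gRevN A`, `gRevN_sound`): entry `k < Kw` of the re-reversed output dominates `lagSum A k · τ̄ · E^k`, where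
  **`lagSum A k = Σ_{i ≤ k} envX A i · max (envX A (k−i−1)) (envX A (k−i))`** is VERBATIM the right side of weil-1's E4-core
  `WeilColumnThetaLagConvolution.integral_mul_sub_le_lagCellSum` (ℕ-subtraction included);
* `hull` (`gsN A`, `gsN_sound`): the output dominates the input pointwise and the floor `GtailW`, and is non-increasing; hence the exported
  hull sequence **`GsR A k := val ((gsN A).getD k GtailW)`** satisfies `GsR A (k+1) ≤ GsR A k` for ALL `k` (`GsR_succ_le`), `= val GtailW` from `Kw` on
  (`GsR_of_le`), and **`e^{−w/2}·τ̄·lagSum A k ≤ GsR A k` for `w ≥ kτ`, `k < Kw`** (`GsR_cell_bound`, with `E = e^{−τ/2}`) — the hypotheses `hGs` of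
  weil-1's E5-bridge `WeilColumnThetaLagStepMajorant`;
* `integLoop` (`integLoop_sound`): `Σ_{k<Kw} GsR A k·(e^{(k+1)τ} − e^{kτ}) ≤ val integ` for `e^{τ} ∈ [val etL, val etH]`;
* **`cross_sound`**: `2·C̄·M̄₀²·[GsR A 0 + Σ_{k<Kw} GsR A k·(e^{(k+1)τ} − e^{kτ}) + T̄] ≤ val (crossTerm A (stage1 A))` for `C̄ ≤ val Cpsi`, `M̄₀ ≤ val M0`,
  `T̄ ≤ val tailInt` — the shape `C·(N·F(N) + ∫_N F) ` of E5 with `stepMajorant_boundary` / `integral_stepMajorant_le`.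

Nothing here bears on the truth of RH.
-/

set_option linter.dupNamespace false  -- the mandated namespace repeats `RiemannHypothesis`
set_option autoImplicit false

namespace Summit.RiemannHypothesis.RiemannHypothesis.Theorems.ThetaTier2

open Real Finset

/-! ## Two `getD` facts -/

/-- Inside the list the default is irrelevant. [folklore] -/
theorem getD_eq_getD_of_lt {l : List ℕ} {j : ℕ} (h : j < l.length) (d d' : ℕ) : l.getD j d = l.getD j d' := by
  rw [List.getD_eq_getElem?_getD, List.getD_eq_getElem?_getD, List.getElem?_eq_getElem h]; rfl

/-- Past the list `getD` returns the default. [folklore] -/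
theorem getD_eq_dflt_of_le {l : List ℕ} {j : ℕ} (h : l.length ≤ j) (d : ℕ) : l.getD j d = d := by
  rw [List.getD_eq_getElem?_getD, List.getElem?_eq_none_iff.2 h]; rfl

/-! ## The lag sum (E4's right side) -/

/-- **`lagSum A k = Σ_{i ≤ k} envX A i · max (envX A (k−i−1)) (envX A (k−i))`** — the right side of `integral_mul_sub_le_lagCellSum` for the
kernel's envelope. [this cell, TIER2-KERNEL-SPEC §5 (K4)] -/
noncomputable def lagSum (A : Inp) (k : ℕ) : ℝ :=
  ∑ i ∈ range (k + 1), envX A i * max (envX A (k - i - 1)) (envX A (k - i))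

/-- `lagSum ≥ 0`. [this cell] -/
theorem lagSum_nonneg (A : Inp) (k : ℕ) : 0 ≤ lagSum A k :=
  sum_nonneg fun i _ => mul_nonneg (envX_nonneg A i) (le_trans (envX_nonneg A _) (le_max_right _ _))

/-! ## `convLoop` -/

/-- `convLoop` with no fuel. [this cell] -/
theorem convLoop_zero (A : Inp) (emax envRest revPre : List ℕ) (ehk : ℕ) (acc : List ℕ) :
    convLoop A emax 0 envRest revPre ehk acc = acc := by
  unfold convLoop; rfl

/-- One step of `convLoop` on a nonempty rest. [this cell] -/
theorem convLoop_succ_cons (A : Inp) (emax : List ℕ) (fuel x : ℕ) (xs revPre : List ℕ) (ehk : ℕ) (acc : List ℕ) :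
    convLoop A emax (fuel + 1) (x :: xs) revPre ehk acc =
      convLoop A emax fuel xs (x :: revPre) (mulU ehk A.ehStep)
        (mulU (mulU ((dot (x :: revPre) emax 0 + (S - 1)) / S) A.tau) ehk :: acc) := by
  conv => lhs; unfold convLoop

/-- The kernel's `G`-list (reversed) for the run. [this cell, TIER2-KERNEL-SPEC §2] -/
def gRevN (A : Inp) : List ℕ := convLoop A (emaxN A) A.Kw (envListN A) [] S []

/-- **The convolution loop is sound** (invariant form): while `envRest` is the suffix of `envListN A` from `k`, `revPre` its reversed prefix,
`E^k ≤ val ehk` and the accumulator's re-reversed entries `j < k` dominate `lagSum A j·τ̄·E^j`, the output (of length `k + fuel`) does so for all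
`j < k + fuel`. [this cell, TIER2-KERNEL-SPEC §2 (E4)] -/
theorem convLoop_inv (A : Inp) (hJK : A.Jt ≤ A.Kw + 1) {τr Eh : ℝ} (hτ0 : 0 ≤ τr) (hτ : τr ≤ val A.tau)
    (hE0 : 0 ≤ Eh) (hE : Eh ≤ val A.ehStep) :
    ∀ (fuel k : ℕ) (envRest revPre : List ℕ) (ehk : ℕ) (acc : List ℕ),
      k + fuel ≤ A.Kw + 1 →
      envRest.length = A.Kw + 1 - k → (∀ i < envRest.length, envRest.getD i 0 = (envListN A).getD (k + i) 0) →
      revPre.length = k → (∀ i < k, revPre.getD i 0 = (envListN A).getD (k - 1 - i) 0) →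
      Eh ^ k ≤ val ehk → acc.length = k →
      (∀ j < k, lagSum A j * τr * Eh ^ j ≤ val (acc.reverse.getD j 0)) →
      (convLoop A (emaxN A) fuel envRest revPre ehk acc).length = k + fuel ∧
      ∀ j < k + fuel, lagSum A j * τr * Eh ^ j ≤ val ((convLoop A (emaxN A) fuel envRest revPre ehk acc).reverse.getD j 0) := by
  have hlen := envListN_length A hJK
  obtain ⟨hmlen, hmval⟩ := val_emaxN A hJK
  intro fuel
  induction fuel with
  | zero =>
    intro k envRest revPre ehk acc _ _ _ _ _ _ hacc hLB
    rw [convLoop_zero]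
    exact ⟨by omega, by simpa using hLB⟩
  | succ fuel ih =>
    intro k envRest revPre ehk acc hkf hrl hrest hpl hpre hehk hacc hLB
    -- the rest is nonempty: its head is `env_k`
    obtain ⟨x, xs, hx⟩ : ∃ x xs, envRest = x :: xs := by
      cases h : envRest with
      | nil => rw [h] at hrl; simp at hrl; omega
      | cons x xs => exact ⟨x, xs, rfl⟩
    subst hx
    have hxk : x = (envListN A).getD k 0 := by have := hrest 0 (by simp); simpa using this
    rw [convLoop_succ_cons]
    -- the new reversed prefix
    have hpre' : ∀ i < k + 1, (x :: revPre).getD i 0 = (envListN A).getD (k + 1 - 1 - i) 0 := by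
      intro i hi
      rcases i with _ | i
      · rw [List.getD_cons_zero, hxk, show k + 1 - 1 - 0 = k by omega]
      · rw [List.getD_cons_succ, hpre i (by omega), show k + 1 - 1 - (i + 1) = k - 1 - i by omega]
    -- the new `H_k`
    have hH : lagSum A k * τr ≤ val (mulU ((dot (x :: revPre) (emaxN A) 0 + (S - 1)) / S) A.tau) := by
      refine le_mulU hτ0 ?_ hτ
      have hd := dot_sound (x :: revPre) (emaxN A)
      have hmin : min (x :: revPre).length (emaxN A).length = k + 1 := by
        rw [List.length_cons, hpl, hmlen, hlen]; omega
      rw [hmin] at hd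
      refine le_trans (le_of_eq ?_) hd
      -- `lagSum` is the reflected dot sum
      unfold lagSum
      rw [← sum_range_reflect]
      refine sum_congr rfl fun i hi => ?_
      have hi' := mem_range.1 hi
      rw [hpre' i (by omega), hmval i (by rw [hlen]; omega)]
      rw [show k + 1 - 1 - i = k - i by omega, show k - (k - i) - 1 = i - 1 by omega,
        show k - (k - i) = i by omega]
      unfold envX
      rfl
    have hG : lagSum A k * τr * Eh ^ k ≤
        val (mulU (mulU ((dot (x :: revPre) (emaxN A) 0 + (S - 1)) / S) A.tau) ehk) :=
      le_mulU (pow_nonneg hE0 k) hH hehk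
    have h := ih (k + 1) xs (x :: revPre) (mulU ehk A.ehStep)
      (mulU (mulU ((dot (x :: revPre) (emaxN A) 0 + (S - 1)) / S) A.tau) ehk :: acc) (by omega)
      (by rw [List.length_cons] at hrl; omega)
      (by
        intro i hi
        have := hrest (i + 1) (by rw [List.length_cons]; omega)
        rw [List.getD_cons_succ] at this
        rw [this, show k + (i + 1) = k + 1 + i by omega])
      (by rw [List.length_cons, hpl]) hpre'
      (by rw [pow_succ]; exact le_mulU hE0 hehk hE)
      (by rw [List.length_cons, hacc])
      (by
        intro j hj
        rcases Nat.lt_succ_iff_lt_or_eq.1 hj with hj' | hj'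
        · rw [getD_reverse_cons_of_lt (by rw [hacc]; exact hj')]; exact hLB j hj'
        · rw [getD_reverse_cons_of_eq (by rw [hacc, hj'])]; rw [hj']; exact hG)
    rw [show k + 1 + fuel = k + (fuel + 1) by omega] at h
    exact h

/-- **`gRevN A` has length `Kw` and its re-reversed entry `k` dominates `lagSum A k·τ̄·E^k`.** [this cell, TIER2-KERNEL-SPEC §2 (E4)] -/
theorem gRevN_sound (A : Inp) (hJK : A.Jt ≤ A.Kw + 1) {τr Eh : ℝ} (hτ0 : 0 ≤ τr) (hτ : τr ≤ val A.tau)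
    (hE0 : 0 ≤ Eh) (hE : Eh ≤ val A.ehStep) :
    (gRevN A).length = A.Kw ∧ ∀ k < A.Kw, lagSum A k * τr * Eh ^ k ≤ val ((gRevN A).reverse.getD k 0) := by
  have h := convLoop_inv A hJK hτ0 hτ hE0 hE A.Kw 0 (envListN A) [] S [] (by omega)
    (by rw [envListN_length A hJK, Nat.sub_zero]) (fun i _ => by rw [Nat.zero_add]) rfl (fun i hi => absurd hi (Nat.not_lt_zero i))
    (by rw [pow_zero, val_S]) rfl (fun j hj => absurd hj (Nat.not_lt_zero j))
  rw [Nat.zero_add] at h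
  unfold gRevN
  exact h

/-! ## `hull` -/

/-- `hull [] cur acc = acc`. [this cell] -/
theorem hull_nil (cur : ℕ) (acc : List ℕ) : hull [] cur acc = acc := by
  unfold hull; rfl

/-- One step of `hull`. [this cell] -/
theorem hull_cons (g : ℕ) (gs : List ℕ) (cur : ℕ) (acc : List ℕ) :
    hull (g :: gs) cur acc = hull gs (max g cur) (max g cur :: acc) := by
  conv => lhs; unfold hull

/-- **The hull is sound** (invariant form): the output keeps `acc` at its end, dominates `max (input entry) cur` in front, and is non-increasing in
front (given the accumulator's head is below `cur`). [this cell, TIER2-KERNEL-SPEC §2 (E5)] -/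
theorem hull_inv : ∀ (gs : List ℕ) (cur : ℕ) (acc : List ℕ), (acc = [] ∨ acc.getD 0 0 ≤ cur) →
    (hull gs cur acc).length = gs.length + acc.length ∧
    (∀ i < acc.length, (hull gs cur acc).getD (gs.length + i) 0 = acc.getD i 0) ∧
    (∀ j < gs.length, max (gs.getD (gs.length - 1 - j) 0) cur ≤ (hull gs cur acc).getD j 0) ∧
    (∀ j < gs.length, (hull gs cur acc).getD (j + 1) 0 ≤ (hull gs cur acc).getD j 0) := by
  intro gs
  induction gs with
  | nil =>
    intro cur acc _
    rw [hull_nil]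
    exact ⟨by simp, fun i _ => by rw [List.length_nil, Nat.zero_add], fun j hj => absurd hj (Nat.not_lt_zero j),
      fun j hj => absurd hj (Nat.not_lt_zero j)⟩
  | cons g gs ih =>
    intro cur acc hH
    rw [hull_cons]
    obtain ⟨L, HA, HB, HC⟩ := ih (max g cur) (max g cur :: acc) (Or.inr (by rw [List.getD_cons_zero]))
    have hlast : (hull gs (max g cur) (max g cur :: acc)).getD gs.length 0 = max g cur := by
      have := HA 0 (by simp); rwa [Nat.add_zero, List.getD_cons_zero] at this
    refine ⟨?_, ?_, ?_, ?_⟩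
    · rw [L, List.length_cons, List.length_cons]; omega
    · intro i hi
      have := HA (i + 1) (by rw [List.length_cons]; omega)
      rw [List.getD_cons_succ] at this
      rw [List.length_cons, show gs.length + 1 + i = gs.length + (i + 1) by omega, this]
    · intro j hj
      rw [List.length_cons] at hj ⊢
      rcases Nat.lt_succ_iff_lt_or_eq.1 hj with hj' | hj'
      · refine le_trans ?_ (HB j hj')
        rw [show gs.length + 1 - 1 - j = (gs.length - 1 - j) + 1 by omega, List.getD_cons_succ]
        exact max_le_max le_rfl (le_max_right g cur)
      · rw [hj', show gs.length + 1 - 1 - gs.length = 0 by omega, List.getD_cons_zero, hlast]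
    · intro j hj
      rw [List.length_cons] at hj
      rcases Nat.lt_succ_iff_lt_or_eq.1 hj with hj' | hj'
      · exact HC j hj'
      · rw [hj', hlast]
        rcases hH with hacc | hacc
        · rw [getD_eq_dflt_of_le (by rw [L, hacc, List.length_cons, List.length_nil]) 0]
          exact Nat.zero_le _
        · by_cases hne : acc.length = 0
          · rw [getD_eq_dflt_of_le (by rw [L, List.length_cons, hne]) 0]
            exact Nat.zero_le _
          · have := HA 1 (by rw [List.length_cons]; omega)
            rw [List.getD_cons_succ] at this
            rw [this]
            exact le_trans hacc (le_max_right g cur)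

/-- The kernel's hull list for the run (`Gs_0 … Gs_{Kw−1}`). [this cell, TIER2-KERNEL-SPEC §2] -/
def gsN (A : Inp) : List ℕ := hull (gRevN A) A.GtailW []

/-- **`GsR A k = val Gs_k`** with `Gs_k = GtailW` from `k = Kw` on — the exported hull sequence. [this cell, TIER2-KERNEL-SPEC §5 (K4)] -/
noncomputable def GsR (A : Inp) (k : ℕ) : ℝ := val ((gsN A).getD k A.GtailW)

/-- `GsR ≥ 0`. [this cell] -/
theorem GsR_nonneg (A : Inp) (k : ℕ) : 0 ≤ GsR A k := val_nonneg _

/-- **`hull` facts for the run**: length `Kw`; entry `k` dominates the `G`-entry and `GtailW`; non-increasing. [this cell] -/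
theorem gsN_sound (A : Inp) (hJK : A.Jt ≤ A.Kw + 1) :
    (gsN A).length = A.Kw ∧
    (∀ k < A.Kw, max ((gRevN A).reverse.getD k 0) A.GtailW ≤ (gsN A).getD k 0) ∧
    (∀ k < A.Kw, (gsN A).getD (k + 1) 0 ≤ (gsN A).getD k 0) := by
  have hL : (gRevN A).length = A.Kw := (gRevN_sound A hJK le_rfl (val_nonneg _) le_rfl (val_nonneg _)).1
  obtain ⟨L, -, HB, HC⟩ := hull_inv (gRevN A) A.GtailW [] (Or.inl rfl)
  rw [hL, List.length_nil, Nat.add_zero] at L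
  rw [hL] at HB HC
  unfold gsN
  refine ⟨L, fun k hk => ?_, HC⟩
  have hrev : (gRevN A).reverse.getD k 0 = (gRevN A).getD (A.Kw - 1 - k) 0 := by
    rw [List.getD_eq_getElem?_getD, List.getD_eq_getElem?_getD, List.getElem?_reverse (by rw [hL]; exact hk), hL]
  rw [hrev]
  exact HB k hk

/-- From `Kw` on the hull sequence is the tail value. [this cell] -/
theorem GsR_of_le (A : Inp) (hJK : A.Jt ≤ A.Kw + 1) {k : ℕ} (hk : A.Kw ≤ k) : GsR A k = val A.GtailW := by
  unfold GsR
  rw [getD_eq_dflt_of_le (by rw [(gsN_sound A hJK).1]; exact hk)]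

/-- The tail value is below every hull entry. [this cell] -/
theorem tail_le_GsR (A : Inp) (hJK : A.Jt ≤ A.Kw + 1) (k : ℕ) : val A.GtailW ≤ GsR A k := by
  by_cases hk : k < A.Kw
  · have e : (gsN A).getD k A.GtailW = (gsN A).getD k 0 := getD_eq_getD_of_lt (by rw [(gsN_sound A hJK).1]; exact hk) _ _
    unfold GsR
    rw [e]
    exact val_mono (le_trans (le_max_right _ _) ((gsN_sound A hJK).2.1 k hk))
  · rw [GsR_of_le A hJK (not_lt.1 hk)]

/-- **The hull sequence is non-increasing (for all `k`).** [this cell, TIER2-KERNEL-SPEC §5 (K4)] -/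
theorem GsR_succ_le (A : Inp) (hJK : A.Jt ≤ A.Kw + 1) (k : ℕ) : GsR A (k + 1) ≤ GsR A k := by
  obtain ⟨L, _, HC⟩ := gsN_sound A hJK
  by_cases hk1 : k + 1 < A.Kw
  · have e1 : (gsN A).getD (k + 1) A.GtailW = (gsN A).getD (k + 1) 0 := getD_eq_getD_of_lt (by rw [L]; exact hk1) _ _
    have e2 : (gsN A).getD k A.GtailW = (gsN A).getD k 0 := getD_eq_getD_of_lt (by rw [L]; omega) _ _
    unfold GsR
    rw [e1, e2]
    exact val_mono (HC k (by omega))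
  · rw [GsR_of_le A hJK (not_lt.1 hk1)]
    exact tail_le_GsR A hJK k

/-- **Entry `k < Kw` of the hull dominates `lagSum A k·τ̄·E^k`.** [this cell, TIER2-KERNEL-SPEC §5 (K4)] -/
theorem lagSum_le_GsR (A : Inp) (hJK : A.Jt ≤ A.Kw + 1) {τr Eh : ℝ} (hτ0 : 0 ≤ τr) (hτ : τr ≤ val A.tau)
    (hE0 : 0 ≤ Eh) (hE : Eh ≤ val A.ehStep) {k : ℕ} (hk : k < A.Kw) : lagSum A k * τr * Eh ^ k ≤ GsR A k := by
  have h1 := (gRevN_sound A hJK hτ0 hτ hE0 hE).2 k hk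
  have h2 := (gsN_sound A hJK).2.1 k hk
  have e : (gsN A).getD k A.GtailW = (gsN A).getD k 0 := getD_eq_getD_of_lt (by rw [(gsN_sound A hJK).1]; exact hk) _ _
  unfold GsR
  rw [e]
  exact h1.trans (val_mono (le_trans (le_max_left _ _) h2))

/-- **(K4), cell form**: for `w` in (or beyond the left end of) lag cell `k < Kw`, `e^{−w/2}·(τ̄·lagSum A k) ≤ GsR A k`, with `e^{−τ/2} ≤ val ehStep`.
[this cell, TIER2-KERNEL-SPEC §5 (K4); THETA-CERT-cc6 E4] -/
theorem GsR_cell_bound (A : Inp) (hJK : A.Jt ≤ A.Kw + 1) {τ τr : ℝ} (hτ0 : 0 ≤ τr) (hτ : τr ≤ val A.tau)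
    (hEh : exp (-(1 / 2 : ℝ) * τ) ≤ val A.ehStep) {k : ℕ} (hk : k < A.Kw) {w : ℝ} (hw : (k : ℝ) * τ ≤ w) :
    exp (-(1 / 2 : ℝ) * w) * (τr * lagSum A k) ≤ GsR A k := by
  have h := lagSum_le_GsR A hJK hτ0 hτ (exp_pos _).le hEh hk
  rw [← exp_nat_mul] at h
  have hmono : exp (-(1 / 2 : ℝ) * w) ≤ exp ((k : ℝ) * (-(1 / 2 : ℝ) * τ)) := exp_le_exp.2 (by nlinarith)
  have h0 : 0 ≤ τr * lagSum A k := mul_nonneg hτ0 (lagSum_nonneg A k)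
  calc exp (-(1 / 2 : ℝ) * w) * (τr * lagSum A k) ≤ exp ((k : ℝ) * (-(1 / 2 : ℝ) * τ)) * (τr * lagSum A k) :=
        mul_le_mul_of_nonneg_right hmono h0
    _ = lagSum A k * τr * exp ((k : ℝ) * (-(1 / 2 : ℝ) * τ)) := by ring
    _ ≤ GsR A k := h

/-! ## `integLoop` -/

/-- `integLoop A [] ewH ewL acc = acc`. [this cell] -/
theorem integLoop_nil (A : Inp) (ewH ewL acc : ℕ) : integLoop A [] ewH ewL acc = acc := by
  unfold integLoop; rfl

/-- One step of `integLoop`. [this cell] -/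
theorem integLoop_cons (A : Inp) (g : ℕ) (gs : List ℕ) (ewH ewL acc : ℕ) :
    integLoop A (g :: gs) ewH ewL acc =
      integLoop A gs (mulU ewH A.etH) (mulD ewL A.etL)
        (acc + mulU g (if mulU ewH A.etH ≥ ewL then mulU ewH A.etH - ewL else 0)) := by
  conv => lhs; unfold integLoop

/-- **`integLoop` is an upper Riemann-type sum**: with `e^{kτ} ∈ [val ewL, val ewH]` at the start,
`val acc + Σ_{j<|gs|} val gs_j·(e^{(k+j+1)τ} − e^{(k+j)τ}) ≤ val (integLoop A gs ewH ewL acc)`. [this cell, TIER2-KERNEL-SPEC §2 (E5)] -/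
theorem integLoop_sound (A : Inp) {τ : ℝ} (hτ0 : 0 ≤ τ) (hetL : val A.etL ≤ exp τ) (hetH : exp τ ≤ val A.etH) :
    ∀ (gs : List ℕ) (k ewH ewL acc : ℕ), exp ((k : ℝ) * τ) ≤ val ewH → val ewL ≤ exp ((k : ℝ) * τ) →
      val acc + ∑ j ∈ range gs.length, val (gs.getD j 0) * (exp (((k : ℝ) + j + 1) * τ) - exp (((k : ℝ) + j) * τ))
        ≤ val (integLoop A gs ewH ewL acc) := by
  intro gs
  induction gs with
  | nil => intro k ewH ewL acc _ _; rw [integLoop_nil]; simp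
  | cons g gs ih =>
    intro k ewH ewL acc hH hL
    rw [integLoop_cons]
    have hstep : exp (((k : ℝ) + 1) * τ) = exp ((k : ℝ) * τ) * exp τ := by rw [← exp_add]; ring_nf
    have hH1 : exp ((((k + 1 : ℕ)) : ℝ) * τ) ≤ val (mulU ewH A.etH) := by
      push_cast; rw [hstep]; exact le_mulU (exp_pos τ).le hH hetH
    have hL1 : val (mulD ewL A.etL) ≤ exp ((((k + 1 : ℕ)) : ℝ) * τ) := by
      push_cast; rw [hstep]; exact mulD_le hL hetL
    have h := ih (k + 1) (mulU ewH A.etH) (mulD ewL A.etL)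
      (acc + mulU g (if mulU ewH A.etH ≥ ewL then mulU ewH A.etH - ewL else 0)) hH1 hL1
    -- the first term
    have hd : exp (((k : ℝ) + 1) * τ) - exp ((k : ℝ) * τ) ≤
        val (if mulU ewH A.etH ≥ ewL then mulU ewH A.etH - ewL else 0) := by
      have h1 : exp (((k : ℝ) + 1) * τ) - exp ((k : ℝ) * τ) ≤ val (mulU ewH A.etH) - val ewL := by
        push_cast at hH1; linarith
      split_ifs with hge
      · unfold val at h1 ⊢; rw [Nat.cast_sub hge, sub_div]; exact h1
      · have : val (mulU ewH A.etH) < val ewL := val_lt_val.2 (not_le.1 hge)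
        rw [val_zero]; linarith
    have hdiff0 : 0 ≤ exp (((k : ℝ) + 1) * τ) - exp ((k : ℝ) * τ) := by
      rw [sub_nonneg]; exact exp_le_exp.2 (by nlinarith)
    have ht : val g * (exp (((k : ℝ) + 1) * τ) - exp ((k : ℝ) * τ)) ≤
        val (mulU g (if mulU ewH A.etH ≥ ewL then mulU ewH A.etH - ewL else 0)) := le_mulU hdiff0 le_rfl hd
    rw [val_add] at h
    rw [List.length_cons, sum_range_succ']
    simp only [List.getD_cons_succ, List.getD_cons_zero, Nat.cast_zero, add_zero, Nat.cast_succ]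
    have hreidx : ∑ j ∈ range gs.length, val (gs.getD j 0) * (exp (((k : ℝ) + ((j : ℝ) + 1) + 1) * τ) - exp (((k : ℝ) + ((j : ℝ) + 1)) * τ))
        = ∑ j ∈ range gs.length, val (gs.getD j 0) * (exp ((((k + 1 : ℕ) : ℝ) + j + 1) * τ) - exp ((((k + 1 : ℕ) : ℝ) + j) * τ)) := by
      refine sum_congr rfl fun j _ => ?_
      push_cast; ring_nf
    rw [hreidx]
    linarith

/-! ## The cross term -/

/-- `crossTerm A (stage1 A)` as an explicit expression in the hull list. [this cell] -/
theorem crossTerm_eq (A : Inp) : crossTerm A (stage1 A) =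
    mulU (mulU (2 * A.Cpsi) (mulU A.M0 A.M0)) ((gsN A).headD 0 + integLoop A (gsN A) S S 0 + A.tailInt) := by
  unfold crossTerm gsN gRevN emaxN envListN
  rfl

/-- **(K4) — THE CROSS TERM**: `2·C̄·M̄₀²·[GsR A 0 + Σ_{k<Kw} GsR A k·(e^{(k+1)τ} − e^{kτ}) + T̄] ≤ val (crossTerm A (stage1 A))` for any reals
`0 ≤ C̄ ≤ val Cpsi`, `0 ≤ M̄₀ ≤ val M0`, `T̄ ≤ val tailInt`, `e^{τ} ∈ [val etL, val etH]`, `τ ≥ 0`, `0 < Kw`.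
[this cell, TIER2-KERNEL-SPEC §5 (K4); THETA-CERT-cc6 E5] -/
theorem cross_sound (A : Inp) (hJK : A.Jt ≤ A.Kw + 1) (hKw : 0 < A.Kw) {τ C M0r T : ℝ} (hτ0 : 0 ≤ τ)
    (hetL : val A.etL ≤ exp τ) (hetH : exp τ ≤ val A.etH) (hC0 : 0 ≤ C) (hC : C ≤ val A.Cpsi)
    (hM0 : 0 ≤ M0r) (hM : M0r ≤ val A.M0) (hT : T ≤ val A.tailInt) :
    2 * C * M0r ^ 2 * (GsR A 0 + ∑ k ∈ range A.Kw, GsR A k * (exp (((k : ℝ) + 1) * τ) - exp ((k : ℝ) * τ)) + T)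
      ≤ val (crossTerm A (stage1 A)) := by
  rw [crossTerm_eq]
  obtain ⟨L, -, -⟩ := gsN_sound A hJK
  -- `headD 0 = getD 0 GtailW` (the list is nonempty)
  have hhead : (gsN A).headD 0 = (gsN A).getD 0 A.GtailW := by
    cases h : gsN A with
    | nil => rw [h] at L; simp at L; omega
    | cons a as => rfl
  -- the integral sum, with the defaults switched inside the list
  have hint := integLoop_sound A hτ0 hetL hetH (gsN A) 0 S S 0 (by rw [Nat.cast_zero, zero_mul, exp_zero, val_S])
    (by rw [Nat.cast_zero, zero_mul, exp_zero, val_S])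
  rw [val_zero, zero_add, L] at hint
  have hint' : ∑ k ∈ range A.Kw, GsR A k * (exp (((k : ℝ) + 1) * τ) - exp ((k : ℝ) * τ)) ≤ val (integLoop A (gsN A) S S 0) := by
    refine le_trans (le_of_eq (sum_congr rfl fun j hj => ?_)) hint
    have e : (gsN A).getD j A.GtailW = (gsN A).getD j 0 := getD_eq_getD_of_lt (by rw [L]; exact mem_range.1 hj) _ _
    unfold GsR
    rw [e]
    push_cast; ring_nf
  have h0 : GsR A 0 = val ((gsN A).headD 0) := by rw [hhead]; rfl
  have hin : GsR A 0 + ∑ k ∈ range A.Kw, GsR A k * (exp (((k : ℝ) + 1) * τ) - exp ((k : ℝ) * τ)) + T ≤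
      val ((gsN A).headD 0 + integLoop A (gsN A) S S 0 + A.tailInt) := by
    rw [val_add, val_add, h0]; linarith
  have h1 : M0r ^ 2 ≤ val (mulU A.M0 A.M0) := by rw [sq]; exact le_mulU hM0 hM hM
  have h2 : 2 * C ≤ val (2 * A.Cpsi) := by rw [val_nat_mul]; push_cast; linarith
  have h3 : 2 * C * M0r ^ 2 ≤ val (mulU (2 * A.Cpsi) (mulU A.M0 A.M0)) := le_mulU (sq_nonneg _) h2 h1
  by_cases hnn : 0 ≤ GsR A 0 + ∑ k ∈ range A.Kw, GsR A k * (exp (((k : ℝ) + 1) * τ) - exp ((k : ℝ) * τ)) + T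
  · exact le_mulU hnn h3 hin
  · exact le_trans (mul_nonpos_iff.2 (Or.inl ⟨by positivity, (not_le.1 hnn).le⟩)) (val_nonneg _)

end Summit.RiemannHypothesis.RiemannHypothesis.Theorems.ThetaTier2
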